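import Summits.QuantumFields.YangMills.Theorems.BalabanLadderIRKernelLargeField
import Summits.QuantumFields.YangMills.Theorems.LangevinControlUVFemtoCurvatureTwoPointCHyperplaneTwist
import Literature.MathematicalPhysics.QuantumFieldTheory.PinnedOneLinkLaplaceWords
import HarnessLib

/-!
# `IR` — THE ZERO-TEMPERATURE ENERGY-GAP KERNEL BOUND, uniform in the exterior (I: master form, excess event)

Spine route `BalabanLadder` (route-QuantumFields-BalabanLadder), crux `IR` (stmt-QuantumFields-19354), registered slot
«af-pincer-Uc» (`b6e69d9662b5b07a`; stubs `stub_onsetUc` / `stub_typCriterionUc` / `stub_afOnsetUc`).  The lead's first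
internal target for `stub_onsetUc` is (A′): exterior-UNIFORM single-cell rarity of the working class
`diluteTyp ∩ Typ_lx^int` (cplan `SUPPLIER-LEDGER-g7.md` §5/§9: «β = ∞ part exact (zero local excess of the pinned
minimiser), remainder = local moderate deviations of the Dirichlet excess on interior balls uniformly in the pinned
exterior»).  This file is that remainder's ENGINE, in the tree's vocabulary only (a sequel of
`…Theorems.BalabanLadderIRKernelLargeField`, p503853, which is the special case «reference configuration `1`, quadratic
modulus»).  Count-neutral helper (`--supports stmt-QuantumFields-19354 --as helper`); no stub claimed, no skeleton
touched, nothing of the desk sketches restated.  Sequel: `…IRKernelEnergyGapExcessSet` (the excess event is closed and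
measurable; faithful representations at the scale `δ = 1/β`).

## Statements

Throughout `ρ` is a continuous unitary representation of a compact group `G`, `β ≥ 0`, `E` a finite set of links of
`ℤ^d`, `η` ANY exterior configuration, `S_E = wilsonBoundaryAction ρ E` the kernel's own Hamiltonian, `γ_E(· | η) =
ymSpecification ρ β E η`, and `m > 0` a mass with `Haar{‖ρ g − 1‖_F ≤ δ} ≥ m` (Frobenius norm).

* §1 (`norm_rho_holonomy_sub_le`, `abs_plaquetteObs_sub_le`, `wilsonBoundaryAction_le_of_close`, `excessSet`) —
  LIPSCHITZ MODULUS: if `U = V` off `E` and `‖ρ(U_e) − ρ(V_e)‖_F ≤ δ` on `E` (`δ ≥ 0`), then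
  `S_E(U) ≤ S_E(V) + 4 √N δ · #(plaquettesTouching E)` (the tree's one-factor Lipschitz lemmas
  `TorusGauge.TwistLower.norm_rho_mul_sub_rho_mul_le` / `norm_rho_inv_sub_rho_inv` + `|Re tr T| ≤ √N ‖T‖_F`); and the
  EXCESS EVENT
  `excessSet ρ E E₀ := {U | ∃ V = U off E, S_E(V) + E₀ ≤ S_E(U)}` (local Dirichlet excess at least `E₀`).
* §2 (`kernel_measureReal_le_of_energyGap`) — MASTER FORM: for measurable `A`, a reference configuration `V₀` and levels
  `h_A`, `h_B` with `S_E ≥ h_A` on the members of `A` glued to `η` and `S_E ≤ h_B` on the configurations glued to `η`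
  that are `δ`-close to `V₀` on `E`:  `γ_E(A | η) ≤ exp(β (h_B − h_A)) / m^{#E}`.
* §3 (`exists_pinned_minimiser`, `kernel_measureReal_excess_le`, `kernel_apply_excess_le`, `…_of_subset`) — for
  measurable `A ⊆ excessSet ρ E E₀`: `γ_E(A | η) ≤ exp(4 √N β δ · n_touch − β E₀) / m^{#E}` for EVERY `η`
  (`n_touch = #(plaquettesTouching E)`), and the same bound read inside any larger kernel `γ_Λ(· | ζ)`, `Λ ⊇ E`,
  uniformly in `ζ` (DLR consistency) — i.e. sup-`ζ` rarity of one window's excess event.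

## Proof

Kernel integral formula (`Tempered.integral_ymSpecification_of_continuous`): `γ_E(A | η) = (∫ 1_A e^{−βS_E})/(∫ e^{−βS_E})`
over product Haar on the links of `E`, glued to `η`.  Numerator `≤ e^{−β h_A}`; denominator `≥ e^{−β h_B} · Haar^E(ball)`
and the translated product ball has mass `≥ m^{#E}` by left invariance (`FreeEnergyLogCoefficient.haar_setOf_norm_sub_le`).
For §3 take `V₀` = a minimiser of `ζ ↦ S_E(ζ ∨ η)` over the compact fibre (exists by continuity), `h_A = min + E₀`
(every member of the excess event exceeds the pinned minimum by `E₀`), `h_B = min + 4√N δ n_touch` (§1).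

Everything here is proved (no `sorry`, no new axioms).  HONEST FRAMING: an elementary energy–entropy bound at the scale of
ONE window, with the polynomial prefactor `m(δ)^{−#E}` (`β^{D #E}` at `δ = 1/β`) that the budget `E₀` must beat; it is the
finite-`β` half of ONE factor's single-cell rarity; clause (i) and the onset statement carry the IR weight; the
conditional chain (Track A) is untouched; not a gap, not Clay.  Refs: Georgii 2011 Def. 2.9; Seiler LNP 159 Ch. 2;
Horn–Johnson Thm 2.2.2; folklore (Laplace lower bound at a minimiser).
-/

set_option autoImplicit false

noncomputable section

open MeasureTheory
open scoped ENNReal Matrix.Norms.Frobenius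
open Literature.Probability.LatticeModels
open Literature.MathematicalPhysics.QuantumLattice
open Literature.MathematicalPhysics.QuantumFieldTheory (haarProbability LatticeRep abs_re_trace_le_sqrt_mul
  isSpecification_ymSpecification_of_t2Space)
open Summit.QuantumFields.YangMills.Theorems.FreeEnergyLogCoefficient (haar_setOf_norm_sub_le)
open Summit.QuantumFields.YangMills.Theorems.FemtoCurvatureTwoPointC.TorusGauge.TwistLower
  (norm_rho_mul_sub_rho_mul_le norm_rho_inv_sub_rho_inv)
open Summit.QuantumFields.YangMills.Cruxes.IR.Tempered (integral_ymSpecification_of_continuous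
  measurable_wilsonWeight_of_continuous)

namespace Summit.QuantumFields.YangMills.Theorems.IRKernelLargeField

/-! ## §1 The Lipschitz modulus of the boundary Wilson action -/

section Lipschitz

variable {d : ℕ} {G : Type*} [Group G] {N : ℕ} (ρ : G →* Matrix (Fin N) (Fin N) ℂ)

/-- **Plaquette holonomies are `1`-Lipschitz in each of their four links** (through a unitary `ρ`, Frobenius norm). -/
theorem norm_rho_holonomy_sub_le (hU : ∀ g, ρ g ∈ Matrix.unitaryGroup (Fin N) ℂ) (U V : LGConfig d G)
    (x : Site d) (i j : Fin d) :
    ‖ρ (plaquetteHolonomyZd U x i j) - ρ (plaquetteHolonomyZd V x i j)‖ ≤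
      ‖ρ (U (x, i)) - ρ (V (x, i))‖ + ‖ρ (U (x + Pi.single i 1, j)) - ρ (V (x + Pi.single i 1, j))‖ +
        ‖ρ (U (x + Pi.single j 1, i)) - ρ (V (x + Pi.single j 1, i))‖ + ‖ρ (U (x, j)) - ρ (V (x, j))‖ := by
  unfold plaquetteHolonomyZd
  calc ‖ρ (U (x, i) * U (x + Pi.single i 1, j) * (U (x + Pi.single j 1, i))⁻¹ * (U (x, j))⁻¹) -
          ρ (V (x, i) * V (x + Pi.single i 1, j) * (V (x + Pi.single j 1, i))⁻¹ * (V (x, j))⁻¹)‖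
      ≤ ‖ρ (U (x, i) * U (x + Pi.single i 1, j) * (U (x + Pi.single j 1, i))⁻¹) -
            ρ (V (x, i) * V (x + Pi.single i 1, j) * (V (x + Pi.single j 1, i))⁻¹)‖ +
          ‖ρ (U (x, j))⁻¹ - ρ (V (x, j))⁻¹‖ := norm_rho_mul_sub_rho_mul_le ρ hU _ _ _ _
    _ ≤ ‖ρ (U (x, i) * U (x + Pi.single i 1, j)) - ρ (V (x, i) * V (x + Pi.single i 1, j))‖ +
          ‖ρ (U (x + Pi.single j 1, i))⁻¹ - ρ (V (x + Pi.single j 1, i))⁻¹‖ +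
          ‖ρ (U (x, j))⁻¹ - ρ (V (x, j))⁻¹‖ := by
        gcongr; exact norm_rho_mul_sub_rho_mul_le ρ hU _ _ _ _
    _ ≤ ‖ρ (U (x, i)) - ρ (V (x, i))‖ + ‖ρ (U (x + Pi.single i 1, j)) - ρ (V (x + Pi.single i 1, j))‖ +
          ‖ρ (U (x + Pi.single j 1, i))⁻¹ - ρ (V (x + Pi.single j 1, i))⁻¹‖ +
          ‖ρ (U (x, j))⁻¹ - ρ (V (x, j))⁻¹‖ := by
        gcongr; exact norm_rho_mul_sub_rho_mul_le ρ hU _ _ _ _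
    _ = _ := by rw [norm_rho_inv_sub_rho_inv ρ hU, norm_rho_inv_sub_rho_inv ρ hU]

/-- **Plaquette energies are `√N`-Lipschitz in the holonomy**: `|Re tr ρ(U_p) − Re tr ρ(V_p)| ≤ √N ‖ρ(U_p) − ρ(V_p)‖_F`. -/
theorem abs_plaquetteObs_sub_le (U V : LGConfig d G) (x : Site d) (i j : Fin d) :
    |plaquetteObs ρ x i j U - plaquetteObs ρ x i j V| ≤
      Real.sqrt N * ‖ρ (plaquetteHolonomyZd U x i j) - ρ (plaquetteHolonomyZd V x i j)‖ := by
  have e : plaquetteObs ρ x i j U - plaquetteObs ρ x i j V =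
      ((ρ (plaquetteHolonomyZd U x i j) - ρ (plaquetteHolonomyZd V x i j)).trace).re := by
    simp only [plaquetteObs, Matrix.trace_sub, Complex.sub_re]
  rw [e]
  exact abs_re_trace_le_sqrt_mul _

/-- **The Lipschitz modulus of the boundary Wilson action.**  If `U = V` off `E` and every link of `E` moves by at
most `δ ≥ 0` through `ρ` (Frobenius norm), then `S_E(U) ≤ S_E(V) + 4 √N δ · #(plaquettesTouching E)`. -/
theorem wilsonBoundaryAction_le_of_close (hU : ∀ g, ρ g ∈ Matrix.unitaryGroup (Fin N) ℂ) (E : Finset (ZdEdge d))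
    {U V : LGConfig d G} {δ : ℝ} (hδ : 0 ≤ δ) (hoff : ∀ e, e ∉ E → U e = V e)
    (hon : ∀ e ∈ E, ‖ρ (U e) - ρ (V e)‖ ≤ δ) :
    wilsonBoundaryAction ρ E U ≤ wilsonBoundaryAction ρ E V + 4 * Real.sqrt N * δ * (plaquettesTouching E).card := by
  classical
  have hlink : ∀ e : ZdEdge d, ‖ρ (U e) - ρ (V e)‖ ≤ δ := fun e => by
    by_cases he : e ∈ E
    · exact hon e he
    · rw [hoff e he, sub_self, norm_zero]; exact hδ
  have hplaq : ∀ p : ZdPlaquette d,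
      ((N : ℝ) - plaquetteObs ρ p.1 p.2.1.1 p.2.1.2 U) ≤
        ((N : ℝ) - plaquetteObs ρ p.1 p.2.1.1 p.2.1.2 V) + 4 * Real.sqrt N * δ := fun p => by
    have h1 := abs_plaquetteObs_sub_le ρ U V p.1 p.2.1.1 p.2.1.2
    have h2 := norm_rho_holonomy_sub_le ρ hU U V p.1 p.2.1.1 p.2.1.2
    have h3 : ‖ρ (plaquetteHolonomyZd U p.1 p.2.1.1 p.2.1.2) - ρ (plaquetteHolonomyZd V p.1 p.2.1.1 p.2.1.2)‖ ≤
        4 * δ := by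
      linarith [hlink (p.1, p.2.1.1), hlink (p.1 + Pi.single p.2.1.1 1, p.2.1.2),
        hlink (p.1 + Pi.single p.2.1.2 1, p.2.1.1), hlink (p.1, p.2.1.2)]
    have h4 : |plaquetteObs ρ p.1 p.2.1.1 p.2.1.2 U - plaquetteObs ρ p.1 p.2.1.1 p.2.1.2 V| ≤
        Real.sqrt N * (4 * δ) :=
      h1.trans (mul_le_mul_of_nonneg_left h3 (Real.sqrt_nonneg _))
    have h5 := (abs_le.1 h4).1
    linarith
  unfold wilsonBoundaryAction
  calc ∑ p ∈ plaquettesTouching E, ((N : ℝ) - plaquetteObs ρ p.1 p.2.1.1 p.2.1.2 U)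
      ≤ ∑ p ∈ plaquettesTouching E, (((N : ℝ) - plaquetteObs ρ p.1 p.2.1.1 p.2.1.2 V) + 4 * Real.sqrt N * δ) :=
        Finset.sum_le_sum fun p _ => hplaq p
    _ = _ := by rw [Finset.sum_add_distrib, Finset.sum_const, nsmul_eq_mul]; ring

/-- **The excess event of the window `E` at level `E₀`**: the configurations whose `E`-window energy can be lowered
by at least `E₀` by re-setting only the links of `E` (local Dirichlet excess at least `E₀`; the complement of a
«local excess `< E₀`» typicality test on the window). -/
def excessSet (E : Finset (ZdEdge d)) (E₀ : ℝ) : Set (LGConfig d G) :=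
  {U | ∃ V : LGConfig d G, (∀ e, e ∉ E → V e = U e) ∧ wilsonBoundaryAction ρ E V + E₀ ≤ wilsonBoundaryAction ρ E U}

/-- Level monotonicity of the excess event. -/
theorem excessSet_mono (E : Finset (ZdEdge d)) {E₀ E₀' : ℝ} (h : E₀ ≤ E₀') :
    excessSet (G := G) ρ E E₀' ⊆ excessSet ρ E E₀ := by
  rintro U ⟨V, hV, hle⟩
  exact ⟨V, hV, by linarith⟩

end Lipschitz

/-! ## §2 The master energy-gap bound -/

section Kernel

variable {d : ℕ} {G : Type*} [Group G] [TopologicalSpace G] [IsTopologicalGroup G] [CompactSpace G]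
  [MeasurableSpace G] [BorelSpace G] {N : ℕ} (ρ : G →* Matrix (Fin N) (Fin N) ℂ)

/-- The product ball about ANY reference configuration has product-Haar mass at least `m ^ #E` (left invariance of
Haar measure: `FreeEnergyLogCoefficient.haar_setOf_norm_sub_le`). -/
theorem pow_le_measureReal_pi_ball_sub (hU : ∀ g, ρ g ∈ Matrix.unitaryGroup (Fin N) ℂ) (E : Finset (ZdEdge d))
    (V₀ : LGConfig d G) {δ m : ℝ} (hm : 0 ≤ m) (hball : ENNReal.ofReal m ≤ haarProbability G {g : G | ‖ρ g - 1‖ ≤ δ}) :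
    m ^ E.card ≤ (Measure.pi fun _ : ↥E => haarProbability G).real
      (Set.pi Set.univ fun e : ↥E => {g : G | ‖ρ g - ρ (V₀ e)‖ ≤ δ}) := by
  have h1 : ∀ e : ↥E, m ≤ (haarProbability G {g : G | ‖ρ g - ρ (V₀ e)‖ ≤ δ}).toReal := fun e => by
    rw [haar_setOf_norm_sub_le ρ hU]
    exact (ENNReal.ofReal_le_iff_le_toReal (measure_ne_top _ _)).1 hball
  rw [measureReal_def, Measure.pi_pi, ENNReal.toReal_prod]
  calc m ^ E.card = ∏ _e : ↥E, m := by rw [Finset.prod_const, Finset.card_univ, Fintype.card_coe]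
    _ ≤ ∏ e : ↥E, (haarProbability G {g : G | ‖ρ g - ρ (V₀ e)‖ ≤ δ}).toReal :=
        Finset.prod_le_prod (fun _ _ => hm) fun e _ => h1 e

/-- **The energy-gap kernel bound, master form, uniform in the exterior.**  For a continuous unitary `ρ`, `β ≥ 0`,
a finite link set `E`, any exterior `η`, a measurable event `A`, a reference configuration `V₀`, a radius `δ` with
`Haar{‖ρ g − 1‖ ≤ δ} ≥ m > 0`, and levels `h_A`, `h_B` such that `S_E ≥ h_A` on the members of `A` glued to `η` off `E`
and `S_E ≤ h_B` on the configurations glued to `η` off `E` that are `δ`-close to `V₀` on `E`: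
`γ_E(A | η) ≤ exp(β (h_B − h_A)) / m^{#E}`. -/
theorem kernel_measureReal_le_of_energyGap (hρ : Continuous ρ) (hU : ∀ g, ρ g ∈ Matrix.unitaryGroup (Fin N) ℂ)
    {β : ℝ} (hβ : 0 ≤ β) (E : Finset (ZdEdge d)) (η : LGConfig d G) {A : Set (LGConfig d G)}
    (hA : MeasurableSet A) (V₀ : LGConfig d G) {δ m : ℝ} (hm : 0 < m)
    (hball : ENNReal.ofReal m ≤ haarProbability G {g : G | ‖ρ g - 1‖ ≤ δ}) {hA' hB' : ℝ}
    (hlow : ∀ U ∈ A, (∀ e, e ∉ E → U e = η e) → hA' ≤ wilsonBoundaryAction ρ E U)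
    (hup : ∀ U : LGConfig d G, (∀ e, e ∉ E → U e = η e) → (∀ e ∈ E, ‖ρ (U e) - ρ (V₀ e)‖ ≤ δ) →
      wilsonBoundaryAction ρ E U ≤ hB') :
    (ymSpecification ρ β E η).real A ≤ Real.exp (β * (hB' - hA')) / m ^ E.card := by
  classical
  set π : Measure (↥E → G) := Measure.pi fun _ : ↥E => haarProbability G with hπ
  set w : LGConfig d G → ℝ := fun U => Real.exp (-β * wilsonBoundaryAction ρ E U) with hw
  have hwm : Measurable w := measurable_wilsonWeight_of_continuous ρ hρ β E
  have hg : Measurable (glueWith E · η) := measurable_glueWith E η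
  have hoff : ∀ ζ : ↥E → G, ∀ e, e ∉ E → glueWith E ζ η e = η e := fun ζ e he =>
    glueWith_apply_not_mem E ζ η he
  -- the kernel integral formula for the indicator of `A`
  have hformula : (ymSpecification ρ β E η).real A =
      (∫ ζ, A.indicator 1 (glueWith E ζ η) * w (glueWith E ζ η) ∂π) / ∫ ζ, w (glueWith E ζ η) ∂π := by
    rw [← integral_indicator_one hA]
    exact integral_ymSpecification_of_continuous ρ hρ β E (measurable_one.indicator hA) η
  -- numerator ≤ e^{-β h_A}
  have hnum : ∫ ζ, A.indicator 1 (glueWith E ζ η) * w (glueWith E ζ η) ∂π ≤ Real.exp (-(β * hA')) := by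
    have hle : ∀ ζ, A.indicator 1 (glueWith E ζ η) * w (glueWith E ζ η) ≤ Real.exp (-(β * hA')) := fun ζ => by
      by_cases hζ : glueWith E ζ η ∈ A
      · rw [Set.indicator_of_mem hζ, Pi.one_apply, one_mul, hw, Real.exp_le_exp]
        have h1 := hlow _ hζ (hoff ζ)
        nlinarith
      · rw [Set.indicator_of_notMem hζ, zero_mul]; exact (Real.exp_pos _).le
    have hi : Integrable (fun ζ => A.indicator 1 (glueWith E ζ η) * w (glueWith E ζ η)) π :=
      Literature.MathematicalPhysics.QuantumLattice.integrable_of_bound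
        (((measurable_one.indicator hA).comp hg).mul (hwm.comp hg)).aestronglyMeasurable
        (C := Real.exp (-(β * hA'))) fun ζ => by
          have h0 : 0 ≤ A.indicator 1 (glueWith E ζ η) * w (glueWith E ζ η) :=
            mul_nonneg (Set.indicator_nonneg (fun _ _ => zero_le_one) _) (Real.exp_pos _).le
          rw [abs_of_nonneg h0]
          exact hle ζ
    calc ∫ ζ, A.indicator 1 (glueWith E ζ η) * w (glueWith E ζ η) ∂π ≤ ∫ _ζ, Real.exp (-(β * hA')) ∂π :=
        integral_mono hi (integrable_const _) hle
      _ = Real.exp (-(β * hA')) := by simp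
  -- denominator ≥ e^{-β h_B} m^{#E}
  set B : Set (↥E → G) := Set.pi Set.univ fun e : ↥E => {g : G | ‖ρ g - ρ (V₀ e)‖ ≤ δ} with hB
  have hBm : MeasurableSet B := MeasurableSet.univ_pi fun e =>
    (isClosed_le (continuous_norm.comp (hρ.sub continuous_const)) continuous_const).measurableSet
  have hden : Real.exp (-(β * hB')) * m ^ E.card ≤ ∫ ζ, w (glueWith E ζ η) ∂π := by
    have hle : ∀ ζ, B.indicator (fun _ => Real.exp (-(β * hB'))) ζ ≤ w (glueWith E ζ η) := fun ζ => by
      by_cases hζ : ζ ∈ B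
      · rw [Set.indicator_of_mem hζ, hw, Real.exp_le_exp]
        have hδ' : ∀ e ∈ E, ‖ρ (glueWith E ζ η e) - ρ (V₀ e)‖ ≤ δ := fun e he => by
          rw [glueWith_apply_mem E ζ η he]
          exact (Set.mem_pi.1 hζ) ⟨e, he⟩ (Set.mem_univ _)
        have h := hup _ (hoff ζ) hδ'
        nlinarith
      · rw [Set.indicator_of_notMem hζ]; exact (Real.exp_pos _).le
    have hi : Integrable (fun ζ => w (glueWith E ζ η)) π := by
      refine Literature.MathematicalPhysics.QuantumLattice.integrable_of_bound (hwm.comp hg).aestronglyMeasurable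
        (C := 1) fun ζ => ?_
      have h0 : 0 ≤ wilsonBoundaryAction ρ E (glueWith E ζ η) :=
        (actionIn_nonneg ρ hU E _).trans (actionIn_le_wilsonBoundaryAction ρ hU E _)
      have h1 : w (glueWith E ζ η) ≤ 1 := by
        simp only [hw]
        rw [Real.exp_le_one_iff]
        nlinarith
      rw [abs_of_nonneg (Real.exp_pos _).le]
      exact h1
    calc Real.exp (-(β * hB')) * m ^ E.card ≤ Real.exp (-(β * hB')) * π.real B :=
        mul_le_mul_of_nonneg_left (pow_le_measureReal_pi_ball_sub ρ hU E V₀ hm.le hball) (Real.exp_pos _).le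
      _ = ∫ ζ, B.indicator (fun _ => Real.exp (-(β * hB'))) ζ ∂π := by
          rw [integral_indicator_const _ hBm, smul_eq_mul, mul_comm]
      _ ≤ ∫ ζ, w (glueWith E ζ η) ∂π :=
          integral_mono ((integrable_const _).indicator hBm) hi hle
  have hden_pos : 0 < Real.exp (-(β * hB')) * m ^ E.card := mul_pos (Real.exp_pos _) (pow_pos hm _)
  rw [hformula]
  calc (∫ ζ, A.indicator 1 (glueWith E ζ η) * w (glueWith E ζ η) ∂π) / ∫ ζ, w (glueWith E ζ η) ∂π
      ≤ Real.exp (-(β * hA')) / (Real.exp (-(β * hB')) * m ^ E.card) :=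
        div_le_div₀ (Real.exp_pos _).le hnum hden_pos hden
    _ = Real.exp (β * (hB' - hA')) / m ^ E.card := by
        rw [div_mul_eq_div_div, ← Real.exp_sub]
        ring_nf

/-! ## §3 The excess event -/

omit [MeasurableSpace G] [BorelSpace G] in
/-- **The pinned problem has a minimiser**: for every exterior `η` some `ζ₀` on the links of `E` minimises
`ζ ↦ S_E(ζ ∨ η)` (continuity on the compact fibre `G^E`). -/
theorem exists_pinned_minimiser (hρ : Continuous ρ) (E : Finset (ZdEdge d)) (η : LGConfig d G) :
    ∃ ζ₀ : ↥E → G, ∀ ζ : ↥E → G,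
      wilsonBoundaryAction ρ E (glueWith E ζ₀ η) ≤ wilsonBoundaryAction ρ E (glueWith E ζ η) := by
  have hc : Continuous fun ζ : ↥E → G => wilsonBoundaryAction ρ E (glueWith E ζ η) :=
    (continuous_wilsonBoundaryAction ρ hρ E).comp
      ((continuous_glueWith_prod E).comp (continuous_const.prodMk continuous_id))
  obtain ⟨ζ₀, _, hζ₀⟩ := isCompact_univ.exists_isMinOn Set.univ_nonempty hc.continuousOn
  exact ⟨ζ₀, fun ζ => (isMinOn_iff.1 hζ₀) ζ (Set.mem_univ ζ)⟩

/-- **The energy-gap kernel bound for the excess event, uniform in the exterior.**  For a continuous unitary `ρ`,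
`β ≥ 0`, a finite link set `E`, ANY exterior `η`, a measurable `A ⊆ excessSet ρ E E₀`, and a radius `δ ≥ 0` with
`Haar{‖ρ g − 1‖ ≤ δ} ≥ m > 0`:
`γ_E(A | η) ≤ exp(4 √N β δ · #(plaquettesTouching E) − β E₀) / m^{#E}`. -/
theorem kernel_measureReal_excess_le (hρ : Continuous ρ) (hU : ∀ g, ρ g ∈ Matrix.unitaryGroup (Fin N) ℂ)
    {β : ℝ} (hβ : 0 ≤ β) (E : Finset (ZdEdge d)) (η : LGConfig d G) {A : Set (LGConfig d G)}
    (hA : MeasurableSet A) {E₀ : ℝ} (hAex : A ⊆ excessSet ρ E E₀) {δ m : ℝ} (hδ : 0 ≤ δ) (hm : 0 < m)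
    (hball : ENNReal.ofReal m ≤ haarProbability G {g : G | ‖ρ g - 1‖ ≤ δ}) :
    (ymSpecification ρ β E η).real A ≤
      Real.exp (β * (4 * Real.sqrt N * δ * (plaquettesTouching E).card) - β * E₀) / m ^ E.card := by
  obtain ⟨ζ₀, hζ₀⟩ := exists_pinned_minimiser ρ hρ E η
  set m₀ : ℝ := wilsonBoundaryAction ρ E (glueWith E ζ₀ η) with hm₀
  have key := kernel_measureReal_le_of_energyGap ρ hρ hU hβ E η hA (glueWith E ζ₀ η) hm hball
    (hA' := m₀ + E₀) (hB' := m₀ + 4 * Real.sqrt N * δ * (plaquettesTouching E).card) ?_ ?_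
  · have e : β * (m₀ + 4 * Real.sqrt N * δ * (plaquettesTouching E).card - (m₀ + E₀)) =
        β * (4 * Real.sqrt N * δ * (plaquettesTouching E).card) - β * E₀ := by ring
    rw [e] at key
    exact key
  · intro U hUA hUη
    obtain ⟨V, hVU, hVle⟩ := hAex hUA
    have hV : V = glueWith E (fun e : ↥E => V e) η := by
      funext e
      by_cases he : e ∈ E
      · rw [glueWith_apply_mem E _ η he]
      · rw [glueWith_apply_not_mem E _ η he, hVU e he, hUη e he]
    have h1 : m₀ ≤ wilsonBoundaryAction ρ E V := by rw [hV]; exact hζ₀ _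
    linarith
  · intro U hUη hUδ
    have hoff : ∀ e, e ∉ E → U e = glueWith E ζ₀ η e := fun e he => by
      rw [glueWith_apply_not_mem E ζ₀ η he, hUη e he]
    have h := wilsonBoundaryAction_le_of_close ρ hU E hδ hoff hUδ
    linarith

/-- **`ℝ≥0∞` form** of the excess-event bound. -/
theorem kernel_apply_excess_le (hρ : Continuous ρ) (hU : ∀ g, ρ g ∈ Matrix.unitaryGroup (Fin N) ℂ)
    {β : ℝ} (hβ : 0 ≤ β) (E : Finset (ZdEdge d)) (η : LGConfig d G) {A : Set (LGConfig d G)}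
    (hA : MeasurableSet A) {E₀ : ℝ} (hAex : A ⊆ excessSet ρ E E₀) {δ m : ℝ} (hδ : 0 ≤ δ) (hm : 0 < m)
    (hball : ENNReal.ofReal m ≤ haarProbability G {g : G | ‖ρ g - 1‖ ≤ δ}) :
    ymSpecification ρ β E η A ≤
      ENNReal.ofReal (Real.exp (β * (4 * Real.sqrt N * δ * (plaquettesTouching E).card) - β * E₀) / m ^ E.card) := by
  haveI : IsFiniteMeasure (ymSpecification ρ β E η) := by
    unfold ymSpecification; infer_instance
  rw [← ofReal_measureReal (measure_ne_top _ _)]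
  exact ENNReal.ofReal_le_ofReal (kernel_measureReal_excess_le ρ hρ hU hβ E η hA hAex hδ hm hball)

/-- **Localised form (DLR consistency): sup-`ζ` rarity of one window's excess event.**  The same bound for a
measurable `A ⊆ excessSet ρ E E₀` read inside any larger kernel `γ_Λ(· | ζ)`, `E ⊆ Λ`, uniformly in `ζ`. -/
theorem kernel_apply_excess_le_of_subset [SecondCountableTopology G] [T2Space G] (hρ : Continuous ρ)
    (hU : ∀ g, ρ g ∈ Matrix.unitaryGroup (Fin N) ℂ) {β : ℝ} (hβ : 0 ≤ β) {E Λ : Finset (ZdEdge d)} (hEΛ : E ⊆ Λ)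
    (ζ : LGConfig d G) {A : Set (LGConfig d G)} (hA : MeasurableSet A) {E₀ : ℝ} (hAex : A ⊆ excessSet ρ E E₀)
    {δ m : ℝ} (hδ : 0 ≤ δ) (hm : 0 < m) (hball : ENNReal.ofReal m ≤ haarProbability G {g : G | ‖ρ g - 1‖ ≤ δ}) :
    ymSpecification ρ β Λ ζ A ≤
      ENNReal.ofReal (Real.exp (β * (4 * Real.sqrt N * δ * (plaquettesTouching E).card) - β * E₀) / m ^ E.card) := by
  have hγ := isSpecification_ymSpecification_of_t2Space (d := d) ρ hρ β
  haveI := hγ.isProbability Λ ζ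
  rw [← hγ.consistent hEΛ ζ _ hA]
  calc ∫⁻ σ, ymSpecification ρ β E σ A ∂(ymSpecification ρ β Λ ζ)
      ≤ ∫⁻ _σ, ENNReal.ofReal (Real.exp (β * (4 * Real.sqrt N * δ * (plaquettesTouching E).card) - β * E₀) /
          m ^ E.card) ∂(ymSpecification ρ β Λ ζ) :=
        lintegral_mono fun σ => kernel_apply_excess_le ρ hρ hU hβ E σ hA hAex hδ hm hball
    _ = _ := by rw [lintegral_const, measure_univ, mul_one]

/-- `measureReal` form of the localised bound. -/
theorem kernel_measureReal_excess_le_of_subset [SecondCountableTopology G] [T2Space G] (hρ : Continuous ρ)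
    (hU : ∀ g, ρ g ∈ Matrix.unitaryGroup (Fin N) ℂ) {β : ℝ} (hβ : 0 ≤ β) {E Λ : Finset (ZdEdge d)} (hEΛ : E ⊆ Λ)
    (ζ : LGConfig d G) {A : Set (LGConfig d G)} (hA : MeasurableSet A) {E₀ : ℝ} (hAex : A ⊆ excessSet ρ E E₀)
    {δ m : ℝ} (hδ : 0 ≤ δ) (hm : 0 < m) (hball : ENNReal.ofReal m ≤ haarProbability G {g : G | ‖ρ g - 1‖ ≤ δ}) :
    (ymSpecification ρ β Λ ζ).real A ≤
      Real.exp (β * (4 * Real.sqrt N * δ * (plaquettesTouching E).card) - β * E₀) / m ^ E.card :=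
  ENNReal.toReal_le_of_le_ofReal (by positivity)
    (kernel_apply_excess_le_of_subset ρ hρ hU hβ hEΛ ζ hA hAex hδ hm hball)

end Kernel

end Summit.QuantumFields.YangMills.Theorems.IRKernelLargeField

end
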